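import Summits.CriticalPhenomena.PercolationContinuityZ3.Theorems.SahiMasterFamilyFAbsorption
import Summits.CriticalPhenomena.PercolationContinuityZ3.Theorems.SahiMasterFamilyFInequalityComparable
import Mathlib.Order.UpperLower.Closure

/-!
# The `F`-inequality is antitone in the THIRD event off `A ∩ B`; the saturation ("core") reduction

Unit `prim-master-conj` (crux anchor stmt-CriticalPhenomena-4575, helper work), gen 23; memo
`run/shared/lean/prim/prim-l12/prim-master-conj/POINTWISE.md` §24.3.  Companion of prim-bnk-2's `…FAbsorption` (`F_anti_left/right`: `F` is antitone in
`A` off `B ∩ G` and in `B` off `A ∩ G`).  `F(A,B;G) := (1 + μG)·μ(A∩B∩G) − μG·μ(A∩B) − μ(A∩G)·μ(B∩G)`.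

* `fIneq_anti_third` — **`F` is antitone in `G` off `A ∩ B`**: if `G ⊆ G'` and no point of `G' ∖ G` lies in `A ∩ B`, then `F(A,B;G') ≤ F(A,B;G)`
  (any events; with `Z = G'∖G`: `F(G') − F(G) = −μZ·μ(A∩B∖G) − μ(A∩G)μ(Z∩B) − μ(B∩G)μ(Z∩A) − μ(Z∩A)μ(Z∩B) ≤ 0`).
* `fIneq_nonneg_of_enlarge` — hence, with bnk-2's two lemmas, **the SATURATION REDUCTION**: if `A ⊆ A'`, `B ⊆ B'`, `G ⊆ G'` with `A'∩B∩G ⊆ A`,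
  `B'∩A'∩G ⊆ B`, `G'∩A'∩B' ⊆ G`, then `F(A',B';G') ≥ 0 ⟹ F(A,B;G) ≥ 0`.
* The CANONICAL saturation of the third event: `(lowerClosure (A ∩ B ∖ G))ᶜ` — the largest up-set `G' ⊇ G` adding no point of `A ∩ B`
  (`isUpperSet_satThird`, `subset_satThird`, `satThird_inter_subset`); `fIneq_nonneg_of_satThird`: `F(A,B;satThird) ≥ 0 ⟹ F(A,B;G) ≥ 0`.  Together with the
  analogous `A ↦ (lowerClosure (B∩G∖A))ᶜ`, `B ↦ …` (bnk-2's absorption) every triple reduces to a CORE triple (`Aᶜ = ↓(B∩G∖A)`, `Bᶜ = ↓(A∩G∖B)`, `Gᶜ = ↓(A∩B∖G)`):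
  the normal form used for the gen-23 censuses (memo §24.3: on cores the good-coordinate criterion holds for all 6,484 cores of `{0,1}^4`, but a core family built from
  two block-nested tribes functions and a saturated majority defeats it asymptotically).
HONEST FRAMING: elementary monotonicity + a reduction; `F ≥ 0` remains OPEN. [this work]
-/

noncomputable section

open scoped Classical

namespace Summit.CriticalPhenomena.PercolationContinuityZ3.Theorems

open Finset Function
open Literature.Combinatorics.Sahi2008
open Literature.Probability.Percolation.DecisionTree (ind)

namespace Pointwise

variable {ι : Type} [Fintype ι]

local notation3 (prettyPrint := false) "μ⟦" p ", " X "⟧" => ex (bernoulliWeight p) (ind X)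

/-- Monotonicity of `μ_p` (local one-liner). [folklore] -/
private theorem mu_mono' (p : ι → unitInterval) {X Y : Set (Set ι)} (h : X ⊆ Y) : μ⟦p, X⟧ ≤ μ⟦p, Y⟧ := by
  have h1 := ex_ind_sub_of_subset (bernoulliWeight p) h
  have h2 := ex_ind_nonneg' p (Y \ X)
  linarith

/-- **`F` is antitone in the third event off `A ∩ B`.**  If `G ⊆ G'` and every point of `G' ∩ A ∩ B` already lies in `G`, then
`F(A,B;G') ≤ F(A,B;G)` (any events `A, B, G, G'`). [this work] -/
theorem fIneq_anti_third (p : ι → unitInterval) {A B G G' : Set (Set ι)} (hsub : G ⊆ G')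
    (hoff : ∀ ω, ω ∈ G' → ω ∈ A → ω ∈ B → ω ∈ G) :
    (1 + μ⟦p, G'⟧) * μ⟦p, A ∩ B ∩ G'⟧ - μ⟦p, G'⟧ * μ⟦p, A ∩ B⟧ - μ⟦p, A ∩ G'⟧ * μ⟦p, B ∩ G'⟧
      ≤ (1 + μ⟦p, G⟧) * μ⟦p, A ∩ B ∩ G⟧ - μ⟦p, G⟧ * μ⟦p, A ∩ B⟧ - μ⟦p, A ∩ G⟧ * μ⟦p, B ∩ G⟧ := by
  have heq : A ∩ B ∩ G' = A ∩ B ∩ G := by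
    ext ω
    constructor
    · rintro ⟨⟨hA, hB⟩, hG'⟩; exact ⟨⟨hA, hB⟩, hoff ω hG' hA hB⟩
    · rintro ⟨⟨hA, hB⟩, hG⟩; exact ⟨⟨hA, hB⟩, hsub hG⟩
  rw [heq]
  -- `Z = G' ∖ G`; the new parts of `A ∩ G'`, `B ∩ G'`, `G'`
  have dG := ex_ind_sub_of_subset (bernoulliWeight p) hsub
  have dA := ex_ind_sub_of_subset (bernoulliWeight p) (Set.inter_subset_inter_right A hsub)
  have dB := ex_ind_sub_of_subset (bernoulliWeight p) (Set.inter_subset_inter_right B hsub)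
  have zG : 0 ≤ ex (bernoulliWeight p) (ind (G' \ G)) := ex_ind_nonneg' p _
  have zA : 0 ≤ ex (bernoulliWeight p) (ind ((A ∩ G') \ (A ∩ G))) := ex_ind_nonneg' p _
  have zB : 0 ≤ ex (bernoulliWeight p) (ind ((B ∩ G') \ (B ∩ G))) := ex_ind_nonneg' p _
  have a0 : 0 ≤ μ⟦p, A ∩ G⟧ := ex_ind_nonneg' p _
  have b0 : 0 ≤ μ⟦p, B ∩ G⟧ := ex_ind_nonneg' p _
  -- `μ(A∩B) ≥ μ(A∩B∩G)`
  have uv : μ⟦p, A ∩ B ∩ G⟧ ≤ μ⟦p, A ∩ B⟧ := mu_mono' p Set.inter_subset_left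
  have eG : μ⟦p, G'⟧ = μ⟦p, G⟧ + ex (bernoulliWeight p) (ind (G' \ G)) := by linarith
  have eA : μ⟦p, A ∩ G'⟧ = μ⟦p, A ∩ G⟧ + ex (bernoulliWeight p) (ind ((A ∩ G') \ (A ∩ G))) := by linarith
  have eB : μ⟦p, B ∩ G'⟧ = μ⟦p, B ∩ G⟧ + ex (bernoulliWeight p) (ind ((B ∩ G') \ (B ∩ G))) := by linarith
  rw [eG, eA, eB]
  nlinarith [mul_nonneg zG (sub_nonneg.2 uv), mul_nonneg zA b0, mul_nonneg zB a0, mul_nonneg zA zB]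

/-- **SATURATION REDUCTION.**  If `A ⊆ A'`, `B ⊆ B'`, `G ⊆ G'` with `A' ∩ B ∩ G ⊆ A`, `B' ∩ A' ∩ G ⊆ B` and `G' ∩ A' ∩ B' ⊆ G`, then
`F(A',B';G') ≤ F(A,B;G)`; in particular `F(A',B';G') ≥ 0 ⟹ F(A,B;G) ≥ 0` (bnk-2's `F_anti_left`, `F_anti_right`, then `fIneq_anti_third`). [this work] -/
theorem fIneq_enlarge_le (p : ι → unitInterval) {A B G A' B' G' : Set (Set ι)}
    (hA : A ⊆ A') (hB : B ⊆ B') (hG : G ⊆ G')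
    (hoffA : ∀ ω, ω ∈ A' → ω ∈ B → ω ∈ G → ω ∈ A)
    (hoffB : ∀ ω, ω ∈ B' → ω ∈ A' → ω ∈ G → ω ∈ B)
    (hoffG : ∀ ω, ω ∈ G' → ω ∈ A' → ω ∈ B' → ω ∈ G) :
    (1 + μ⟦p, G'⟧) * μ⟦p, A' ∩ B' ∩ G'⟧ - μ⟦p, G'⟧ * μ⟦p, A' ∩ B'⟧ - μ⟦p, A' ∩ G'⟧ * μ⟦p, B' ∩ G'⟧
      ≤ (1 + μ⟦p, G⟧) * μ⟦p, A ∩ B ∩ G⟧ - μ⟦p, G⟧ * μ⟦p, A ∩ B⟧ - μ⟦p, A ∩ G⟧ * μ⟦p, B ∩ G⟧ := by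
  have h1 := SahiFInduction.F_anti_left p (B := B) (G := G) hA hoffA
  have h2 := SahiFInduction.F_anti_right p (A := A') (G := G) hB hoffB
  have h3 := fIneq_anti_third p (A := A') (B := B') hG hoffG
  linarith

/-- `F(A',B';G') ≥ 0 ⟹ F(A,B;G) ≥ 0` under the hypotheses of `fIneq_enlarge_le`. [this work] -/
theorem fIneq_nonneg_of_enlarge (p : ι → unitInterval) {A B G A' B' G' : Set (Set ι)}
    (hA : A ⊆ A') (hB : B ⊆ B') (hG : G ⊆ G')
    (hoffA : ∀ ω, ω ∈ A' → ω ∈ B → ω ∈ G → ω ∈ A)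
    (hoffB : ∀ ω, ω ∈ B' → ω ∈ A' → ω ∈ G → ω ∈ B)
    (hoffG : ∀ ω, ω ∈ G' → ω ∈ A' → ω ∈ B' → ω ∈ G)
    (h : 0 ≤ (1 + μ⟦p, G'⟧) * μ⟦p, A' ∩ B' ∩ G'⟧ - μ⟦p, G'⟧ * μ⟦p, A' ∩ B'⟧ - μ⟦p, A' ∩ G'⟧ * μ⟦p, B' ∩ G'⟧) :
    0 ≤ (1 + μ⟦p, G⟧) * μ⟦p, A ∩ B ∩ G⟧ - μ⟦p, G⟧ * μ⟦p, A ∩ B⟧ - μ⟦p, A ∩ G⟧ * μ⟦p, B ∩ G⟧ :=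
  le_trans h (fIneq_enlarge_le p hA hB hG hoffA hoffB hoffG)

/-! ### The canonical saturation of the third event -/

-- The canonical saturated third event is `(↑(lowerClosure ((A ∩ B) \ G)))ᶜ`: the largest up-set containing `G` and adding no point of `A ∩ B`
-- (we keep it inlined rather than introducing a definition).

omit [Fintype ι] in
/-- The saturated third event is an up-set (complement of a lower set). [this work] -/
theorem isUpperSet_satThird (A B G : Set (Set ι)) : IsUpperSet (↑(lowerClosure ((A ∩ B) \ G)) : Set (Set ι))ᶜ :=
  (lowerClosure ((A ∩ B) \ G)).lower.compl

omit [Fintype ι] in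
/-- An up-set `G` is contained in its saturation. [this work] -/
theorem subset_satThird {A B G : Set (Set ι)} (hG : IsUpperSet G) : G ⊆ (↑(lowerClosure ((A ∩ B) \ G)) : Set (Set ι))ᶜ := by
  intro ω hω hmem
  obtain ⟨r, hr, hle⟩ := mem_lowerClosure.1 hmem
  exact hr.2 (hG hle hω)

omit [Fintype ι] in
/-- The saturation adds no point of `A ∩ B`: `satThird A B G ∩ A ∩ B ⊆ G`. [this work] -/
theorem satThird_inter_subset (A B G : Set (Set ι)) : ∀ ω, ω ∈ (↑(lowerClosure ((A ∩ B) \ G)) : Set (Set ι))ᶜ → ω ∈ A → ω ∈ B → ω ∈ G := by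
  intro ω hω hA hB
  by_contra hG
  exact hω (subset_lowerClosure ⟨⟨hA, hB⟩, hG⟩)

/-- **Core reduction in the third event**: for an up-set `G`, `F(A,B; satThird A B G) ≤ F(A,B;G)`, so it suffices to prove `F ≥ 0` for the saturated
third event (whose complement is the down-set generated by `A ∩ B ∖ G`). [this work] -/
theorem fIneq_satThird_le (p : ι → unitInterval) {A B G : Set (Set ι)} (hG : IsUpperSet G) :
    (1 + μ⟦p, (↑(lowerClosure ((A ∩ B) \ G)) : Set (Set ι))ᶜ⟧) * μ⟦p, A ∩ B ∩ (↑(lowerClosure ((A ∩ B) \ G)) : Set (Set ι))ᶜ⟧ - μ⟦p, (↑(lowerClosure ((A ∩ B) \ G)) : Set (Set ι))ᶜ⟧ * μ⟦p, A ∩ B⟧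
        - μ⟦p, A ∩ (↑(lowerClosure ((A ∩ B) \ G)) : Set (Set ι))ᶜ⟧ * μ⟦p, B ∩ (↑(lowerClosure ((A ∩ B) \ G)) : Set (Set ι))ᶜ⟧
      ≤ (1 + μ⟦p, G⟧) * μ⟦p, A ∩ B ∩ G⟧ - μ⟦p, G⟧ * μ⟦p, A ∩ B⟧ - μ⟦p, A ∩ G⟧ * μ⟦p, B ∩ G⟧ :=
  fIneq_anti_third p (subset_satThird hG) (satThird_inter_subset A B G)

/-- `F ≥ 0` for the saturated third event implies `F(A,B;G) ≥ 0`. [this work] -/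
theorem fIneq_nonneg_of_satThird (p : ι → unitInterval) {A B G : Set (Set ι)} (hG : IsUpperSet G)
    (h : 0 ≤ (1 + μ⟦p, (↑(lowerClosure ((A ∩ B) \ G)) : Set (Set ι))ᶜ⟧) * μ⟦p, A ∩ B ∩ (↑(lowerClosure ((A ∩ B) \ G)) : Set (Set ι))ᶜ⟧ - μ⟦p, (↑(lowerClosure ((A ∩ B) \ G)) : Set (Set ι))ᶜ⟧ * μ⟦p, A ∩ B⟧
        - μ⟦p, A ∩ (↑(lowerClosure ((A ∩ B) \ G)) : Set (Set ι))ᶜ⟧ * μ⟦p, B ∩ (↑(lowerClosure ((A ∩ B) \ G)) : Set (Set ι))ᶜ⟧) :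
    0 ≤ (1 + μ⟦p, G⟧) * μ⟦p, A ∩ B ∩ G⟧ - μ⟦p, G⟧ * μ⟦p, A ∩ B⟧ - μ⟦p, A ∩ G⟧ * μ⟦p, B ∩ G⟧ :=
  le_trans h (fIneq_satThird_le p hG)

end Pointwise

end Summit.CriticalPhenomena.PercolationContinuityZ3.Theorems
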